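import Summits.CriticalPhenomena.PercolationContinuityZ3.Theorems.PercNearOneGluingNoHeavyLowerTailMajorityGluingQCert3SliceProd
import HarnessLib

/-!
# Slice evaluator soundness, part 3: the slices partition the contribution list (lane prim-rate, constants-miner 1, gen 34; NEXT-g35 item 0)

Support file for the closed crux `NoHeavyLowerTail` (stmt-CriticalPhenomena-4575), majority-gluing line; companion of `…QCert3Slice` / `…QCert3SliceLin` / `…QCert3SliceProd`.
**`Cert3.sum_sliceContribs`**: under the index bounds of `checkW3`, `Σ_{i₀ < NV} evalC val (c.sliceContribs i₀) = evalC val c.contribs` (family by family: `ell2` / `lin3` by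
`sum_linSlice`, rows / squares by `sum_prodSlice`), and **`Cert3.eval_nonneg_of_slices`**: if every slice check passes, the contribution list evaluates nonnegatively at every
nonnegative point — the hypothesis of `Cert3.sound3_of_eval` and `cut_of_eval3_count` (…QCert3Range).  No sorries.
-/

namespace Summit.CriticalPhenomena.PercolationContinuityZ3.Theorems

namespace HubOnly
namespace QCert

noncomputable section

/-- A finite sum of list sums is the list sum of the finite sums. -/
theorem sum_list_map {ι α : Type*} (s : Finset ι) (l : List α) (g : ι → α → ℝ) :
    ∑ i ∈ s, (l.map (g i)).sum = (l.map fun a => ∑ i ∈ s, g i a).sum := by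
  induction l with
  | nil => simp
  | cons a l ih => simp only [List.map_cons, List.sum_cons, Finset.sum_add_distrib, ih]

/-- A finite sum of `evalC`s of flattened mapped lists, elementwise. -/
theorem sum_evalC_flatten_map {ι α : Type*} (s : Finset ι) (l : List α) (f : ι → α → List (ℕ × ℤ)) (val : ℕ → ℝ) :
    ∑ i ∈ s, evalC val ((l.map (f i)).flatten) = (l.map fun a => ∑ i ∈ s, evalC val (f i a)).sum := by
  simp_rw [evalC_flatten, List.map_map]
  exact sum_list_map s l (fun i a => evalC val (f i a))

/-- The singleton support of `· = d`: `Σ_{i<N} [i = d]·f i = f d` for `d < N`. -/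
theorem sum_suppOf_eq (N d : ℕ) (hd : d < N) (f : ℕ → ℝ) :
    ((suppOf N (fun i => decide (i = d))).map f).sum = f d := by
  rw [sum_suppOf]
  simp only [decide_eq_true_eq]
  rw [Finset.sum_ite_eq' (Finset.range N) d f, if_pos (Finset.mem_range.2 hd)]

/-- `evalC` of a cons. -/
theorem evalC_cons (val : ℕ → ℝ) (x : ℕ × ℤ) (l : List (ℕ × ℤ)) : evalC val (x :: l) = (x.2 : ℝ) * val x.1 + evalC val l := by
  simp [evalC]

namespace Cert3

variable (c : Cert3)

/-- `ell2` entries: the slices sum to `ell2C`. -/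
theorem sum_slice_ell2 (val : ℕ → ℝ) (e : ℕ × ℕ × ℕ) (ha : e.1 < c.NV) (hb : e.2.1 < c.NV) :
    ∑ i₀ ∈ Finset.range c.NV, evalC val
        (linSlice c.NV i₀ (fun i => i = c.base.D) e.1 e.2.1 ((e.2.2 : ℤ) * c.base.cN) ++
          linSlice c.NV i₀ c.base.tMem e.1 e.2.1 (-((e.2.2 : ℤ) * c.base.cD))) = evalC val (c.ell2C e) := by
  simp_rw [evalC_append]
  rw [Finset.sum_add_distrib, sum_linSlice _ _ _ _ _ ha hb, sum_linSlice _ _ _ _ _ ha hb, ell2C, evalC_cons,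
    evalC_map val (suppOf c.NV fun i => decide (i = c.base.D)), sum_suppOf_eq _ _ c.D_lt_NV]

/-- `lin3` entries: the slices sum to `lin3C`. -/
theorem sum_slice_lin3 (val : ℕ → ℝ) (e : ℕ × ℕ × ℕ × ℕ × ℕ) (ha : e.2.2.1 < c.NV) (hb : e.2.2.2.1 < c.NV) :
    ∑ i₀ ∈ Finset.range c.NV, evalC val
        (if e.1 = 1 then
          linSlice c.NV i₀ (fun i => i = c.base.D) e.2.2.1 e.2.2.2.1 (-(e.2.2.2.2 : ℤ)) ++
            linSlice c.NV i₀ (c.base.margMem e.2.1) e.2.2.1 e.2.2.2.1 (e.2.2.2.2 : ℤ)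
        else
          linSlice c.NV i₀ (c.base.eMem (e.2.1 + 1)) e.2.2.1 e.2.2.2.1 (-(e.2.2.2.2 : ℤ)) ++
            linSlice c.NV i₀ (c.base.eMem e.2.1) e.2.2.1 e.2.2.2.1 (e.2.2.2.2 : ℤ)) = evalC val (c.lin3C e) := by
  unfold lin3C
  by_cases hk : e.1 = 1
  · simp_rw [if_pos hk, evalC_append]
    rw [Finset.sum_add_distrib, sum_linSlice _ _ _ _ _ ha hb, sum_linSlice _ _ _ _ _ ha hb, evalC_cons,
      evalC_map val (suppOf c.NV fun i => decide (i = c.base.D)), sum_suppOf_eq _ _ c.D_lt_NV]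
  · simp_rw [if_neg hk, evalC_append]
    rw [Finset.sum_add_distrib, sum_linSlice _ _ _ _ _ ha hb, sum_linSlice _ _ _ _ _ ha hb]

/-- Row entries: the slices sum to `row3C`. -/
theorem sum_slice_row (val : ℕ → ℝ) (r : RowE3) (ht : r.t < c.NV) :
    ∑ i₀ ∈ Finset.range c.NV, evalC val
        (prodSlice c.NV i₀ (tb r.row.m3) (tb r.row.m4) r.t (fun _ _ => -(r.row.n : ℤ)) ++
          prodSlice c.NV i₀ (tb r.row.m1) (tb r.row.m2) r.t (fun _ _ => (r.row.n : ℤ))) = evalC val (c.row3C r) := by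
  simp_rw [evalC_append]
  rw [Finset.sum_add_distrib, sum_prodSlice _ _ _ _ _ ht, sum_prodSlice _ _ _ _ _ ht, row3C, evalC_append]
  rfl

/-- Square entries: the slices sum to `sq3C`. -/
theorem sum_slice_sq (val : ℕ → ℝ) (s : SqE3) (ht : s.t < c.NV) :
    ∑ i₀ ∈ Finset.range c.NV, evalC val
        (prodSlice c.NV i₀ (tb (s.sq.m1 ||| s.sq.m2)) (tb (s.sq.m1 ||| s.sq.m2)) s.t
          (fun p q => -((s.sq.n : ℤ) * s.sq.u p * s.sq.u q))) = evalC val (c.sq3C s) := by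
  rw [sum_prodSlice _ _ _ _ _ ht, sq3C]

/-- **The slices partition the contribution list:** `Σ_{i₀ < NV} evalC (sliceContribs i₀) = evalC contribs` (index bounds from `checkW3`). -/
theorem sum_sliceContribs (hW : c.checkW3 = true) (val : ℕ → ℝ) :
    ∑ i₀ ∈ Finset.range c.NV, evalC val (c.sliceContribs i₀) = evalC val c.contribs := by
  obtain ⟨_, _, _, hell, hlin, hrow, hsq⟩ := c.checkW3_spec hW
  unfold sliceContribs contribs
  simp_rw [evalC_append]
  rw [Finset.sum_add_distrib, Finset.sum_add_distrib, Finset.sum_add_distrib]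
  congr 1
  congr 1
  congr 1
  · -- ell2
    rw [sum_evalC_flatten_map, evalC_flatten, List.map_map]
    congr 1
    refine List.map_congr_left fun e he => ?_
    rw [Function.comp_apply]
    exact c.sum_slice_ell2 val e (hell e he).1 (hell e he).2
  · -- lin3
    rw [sum_evalC_flatten_map, evalC_flatten, List.map_map]
    congr 1
    refine List.map_congr_left fun e he => ?_
    rw [Function.comp_apply]
    exact c.sum_slice_lin3 val e (hlin e he).2.1 (hlin e he).2.2
  · -- rows (two levels of flatten)
    rw [sum_evalC_flatten_map, evalC_flatten, List.map_map]
    congr 1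
    refine List.map_congr_left fun ch hch => ?_
    rw [Function.comp_apply, sum_evalC_flatten_map, evalC_flatten, List.map_map]
    congr 1
    refine List.map_congr_left fun r hr => ?_
    rw [Function.comp_apply]
    exact c.sum_slice_row val r (hrow ch hch r hr).2
  · -- squares
    rw [sum_evalC_flatten_map, evalC_flatten, List.map_map]
    congr 1
    refine List.map_congr_left fun ch hch => ?_
    rw [Function.comp_apply, sum_evalC_flatten_map, evalC_flatten, List.map_map]
    congr 1
    refine List.map_congr_left fun s hs => ?_
    rw [Function.comp_apply]
    exact c.sum_slice_sq val s (hsq ch hch s hs)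

/-- **SOUNDNESS OF THE SLICE CHECKS:** if every slice `i₀ < NV` passes, the contribution list evaluates nonnegatively at every nonnegative point — feed this to
`Cert3.sound3_of_eval` / `cut_of_eval3_count`. -/
theorem eval_nonneg_of_slices (hW : c.checkW3 = true) (fuel : ℕ) (h : ∀ i₀ < c.NV, c.checkSlice i₀ fuel = true) :
    ∀ v : ℕ → ℝ, (∀ i, 0 ≤ v i) → 0 ≤ evalC (val3 c.NV v) c.contribs := by
  intro v hv
  rw [← c.sum_sliceContribs hW]
  exact Finset.sum_nonneg fun i₀ hi₀ => c.evalC_slice_nonneg i₀ fuel (h i₀ (Finset.mem_range.1 hi₀)) _ (val3_nonneg _ v hv)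

end Cert3

end

end QCert
end HubOnly

end Summit.CriticalPhenomena.PercolationContinuityZ3.Theorems
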